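import Summits.CriticalPhenomena.PercolationContinuityZ3.Theorems.PercNearOneGluingNoHeavyQuantFarTreeBlockComb
import Summits.CriticalPhenomena.PercolationContinuityZ3.Theorems.PercNearOneGluingNoHeavyQuantBlobWalkBottomRoom
import Summits.CriticalPhenomena.PercolationContinuityZ3.Theorems.PercNearOneGluingNoHeavyQuantBlobWalkExchangeVertex
import HarnessLib

/-!
# QUANT lane R8, FAR on trees: block-combs with ROOM AT THE BOTTOM (a structural FAR family, no budget) and the TIED-OR-GLUED vertex
# reduction on the tree side

builds on p205010 (kernel theorem, internal audit signed; external expert review pending)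

Support file (`--supports stmt-CriticalPhenomena-4575`), QUANT lane typer seat prim-quant-stmt (gen 14), rung R8 of
`run/shared/lean/prim/quant/LADDER.md`; typer targets of the gen-11 lead (lane INBOX 2026-08-20T22:58Z (3) and 23:25Z (2);
`prim-quant-lead-g11/LEAD-NOTES-G11.md` N22 (1b), (3′)(i)).  Theorems only; no definitions (the `local notation3` `CB[a, p, m]` of
`…QuantBlobWalk.lean`, verbatim), no sorries, standard axioms.  Data as in `Quant.blockComb_count_eq` (`…QuantBlockCombCount.lean`): a block-comb
around the relay `a` in the gate coordinates of `Quant.FarTreeRow`, blobs = fibres `Q 0 … Q (K−1)` of `P` off the terminal class, root-first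
(nested chain parts, pairwise disjoint private parts), sizes `sz`, private gates `p`, chain weights `w` (non-increasing), `x = ∏_{P a} q`, terminal `c`.

* `Quant.farTree_blockComb_of_bottomRoom` — **FAR AT LAYER `j`, NO BUDGET HYPOTHESIS, for every block-comb (`a` least likely) whose deepest blobs
  `m ≤ k < K` have private gates `≥ 1/2`, satisfy `x ≤ w (K−1) · p k` (automatic for blobs hanging at the lowest attachment vertex) and carry
  `Σ_{m≤k<K} sz k ≥ 2j + 2 − c` relays:** `P(#{y ∈ A : P y open} ≤ j) ≤ 1 − x`.  (= lead g11's "ROOM AT THE BOTTOM" proposition N22 (3′)(i),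
  for arbitrary gates `≥ 1/2` in the group rather than one tied gate, arbitrary blobs above; `BlobWalk.exchange_of_bottomRoom` +
  `Quant.farTree_blockComb_of_exchange`.)  With `t ≥ 1 − x` this is `Quant.FarTreeRow`'s conclusion on the family — blobs at several
  heights with distinct private gates, outside p1 g7's bare-leaf cell in general, and it needs no `EN > 2j`.
* `Quant.farTree_blockComb_of_vertices` — **TIED-OR-GLUED REDUCTION, tree side (N22 (1b))**: for floors `ℓ k ≤ p k`, if the exchange inequality
  holds at every gate vector `q'` with `q' k ∈ {ℓ k, 1}` (`k < K`) — same sizes, chain weights, `x`, `c` — then `P(#{y ∈ A : P y open} ≤ j) ≤ 1 − x`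
  (`BlobWalk.exchange_le_of_vertices` + `Quant.farTree_blockComb_of_exchange`).  With `ℓ k = x / w k` (the argmin floors) the vertices are the
  tied-or-glued patterns of the lead's (BCV).
RELATION TO THE LEAD'S FILES: lead g11's `Quant.IndepBlob.twoHeight_exchange_of_bottomRoom` (`…QuantTwoHeightFar.lean`, p240695, simultaneous
and independent) is the two-height exchange inequality in the Finset-weight vocabulary; this file is the `Quant.FarTreeRow`-shape statement for
block-combs with any number of heights above the bottom group (walk side `…QuantBlobWalkBottomRoom.lean`, same seat).
[this work]; [cite: KozmaNitzan2024, Conjecture 3 (p. 15)] (the gluing rows `Quant.FarTreeRow` serves).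
-/

noncomputable section

namespace Summit.CriticalPhenomena.PercolationContinuityZ3.Theorems

namespace Quant

open Finset MeasureTheory
open Literature.Probability.LatticeModels
open Literature.Probability.Percolation
open scoped Classical

/-- `CB[a, p, m] t` = probability that the open mass of the first `m` blobs (sizes `a`, gates `p`) is `≤ t` (the recursion of
`…QuantBlobWalk.lean`, verbatim). -/
local notation3 "CB[" a ", " p ", " m "]" =>
  (Nat.rec (motive := fun _ => ℤ → ℝ) (fun t => if (0 : ℤ) ≤ t then (1 : ℝ) else 0)
    (fun n f t => (p : ℕ → ℝ) n * f (t - ((a : ℕ → ℕ) n : ℤ)) + (1 - (p : ℕ → ℝ) n) * f t) (m : ℕ))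

variable {ι : Type*} [Fintype ι] [DecidableEq ι]

/-- **FAR at layer `j` for block-combs with ROOM AT THE BOTTOM — no budget hypothesis.**  Data as in `Quant.blockComb_count_eq`, `a` least
likely (`x ≤ w k · p k`); a suffix group of blobs `m ≤ k < K` with private gates `p k ≥ 1/2`, `x ≤ w (K−1) · p k`, and
`2j + 2 ≤ c + Σ_{m≤k<K} sz k`.  Then `P(#{y ∈ A : P y open} ≤ j) ≤ 1 − x`. [this work] -/
theorem farTree_blockComb_of_bottomRoom (P : ι → Finset ι) (q : ι → unitInterval) (a : ι) (x : ℝ)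
    (hx : x = ∏ y ∈ P a, (q y : ℝ)) (K : ℕ) (A : Finset ι) (Q : ℕ → Finset ι) (sz : ℕ → ℕ) (c : ℕ) (p w : ℕ → ℝ)
    (ha : a ∈ A) (hc : c = (A.filter fun y => P y = P a).card)
    (hsz : ∀ k, k < K → sz k = (A.filter fun y => P y = Q k).card)
    (hcover : ∀ y ∈ A, P y = P a ∨ ∃ k, k < K ∧ P y = Q k)
    (hQne : ∀ k, k < K → Q k ≠ P a)
    (hinj : ∀ k k', k < K → k' < K → Q k = Q k' → k = k')
    (hmono : ∀ k k', k ≤ k' → k' < K → Q k ∩ P a ⊆ Q k' ∩ P a)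
    (hdisj : ∀ k k', k < K → k' < K → k ≠ k' → Q k ∩ Q k' ⊆ P a)
    (hpdef : ∀ k, p k = ∏ y ∈ Q k \ P a, (q y : ℝ))
    (hwdef : ∀ k, w k = ∏ y ∈ Q k ∩ P a, (q y : ℝ))
    (hxw : ∀ k, k < K → x ≤ w k * p k) (j : ℕ) (m : ℕ) (hmK : m ≤ K)
    (hgrp : ∀ k, m ≤ k → k < K → 1 / 2 ≤ p k ∧ x ≤ w (K - 1) * p k)
    (hB : 2 * j + 2 ≤ c + ∑ k ∈ Finset.Ico m K, sz k) :
    (prodBernoulli q).real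
        {ω : Set ι | (A.filter fun y => ((P y : Finset ι) : Set ι) ⊆ ω).card ≤ j} ≤ 1 - x := by
  have hq0 : ∀ y, (0 : ℝ) ≤ q y := fun y => (q y).2.1
  have hq1 : ∀ y, (q y : ℝ) ≤ 1 := fun y => (q y).2.2
  have hprod01 : ∀ s : Finset ι, 0 ≤ ∏ y ∈ s, (q y : ℝ) ∧ ∏ y ∈ s, (q y : ℝ) ≤ 1 := fun s =>
    ⟨Finset.prod_nonneg fun y _ => hq0 y, Finset.prod_le_one (fun y _ => hq0 y) fun y _ => hq1 y⟩
  have hx0 : 0 ≤ x := by rw [hx]; exact (hprod01 _).1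
  have hp01 : ∀ k, 0 ≤ p k ∧ p k ≤ 1 := fun k => by rw [hpdef k]; exact hprod01 _
  refine farTree_blockComb_of_exchange P q a x hx K A Q sz c p w ha hc hsz hcover hQne hinj hmono hdisj hpdef hwdef j ?_
  refine BlobWalk.exchange_of_bottomRoom sz p hp01 K m hmK j c x w (w (K - 1)) hx0 hxw ?_ hgrp hB
  -- the deepest chain weight is the smallest (nested chain parts)
  intro k hk
  rw [hwdef k, hwdef (K - 1)]
  exact Finset.prod_le_prod_of_subset_of_le_one (hmono k (K - 1) (by omega) (by omega)) (fun y _ => hq0 y) fun y _ _ => hq1 y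

/-- **Tied-or-glued reduction, tree side (N22 (1b)).**  Data as in `Quant.blockComb_count_eq`; floors `ℓ k ≤ p k` (`k < K`).  If the exchange
inequality `x·CB[sz,q',K](j − c) ≤ Σ_{k<K} (w k − x)·q' k·(CB[sz,q',k] j − CB[sz,q',k](j − sz k))` holds for every gate vector `q'` with
`q' k ∈ {ℓ k, 1}` (`k < K`), then `P(#{y ∈ A : P y open} ≤ j) ≤ 1 − x`.  (The exchange functional is affine in each gate:
`BlobWalk.exchange_le_of_vertices`, lead g11.)  With `ℓ k = x / w k` the vertices are the tied-or-glued patterns. [this work] -/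
theorem farTree_blockComb_of_vertices (P : ι → Finset ι) (q : ι → unitInterval) (a : ι) (x : ℝ)
    (hx : x = ∏ y ∈ P a, (q y : ℝ)) (K : ℕ) (A : Finset ι) (Q : ℕ → Finset ι) (sz : ℕ → ℕ) (c : ℕ) (p w : ℕ → ℝ)
    (ha : a ∈ A) (hc : c = (A.filter fun y => P y = P a).card)
    (hsz : ∀ k, k < K → sz k = (A.filter fun y => P y = Q k).card)
    (hcover : ∀ y ∈ A, P y = P a ∨ ∃ k, k < K ∧ P y = Q k)
    (hQne : ∀ k, k < K → Q k ≠ P a)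
    (hinj : ∀ k k', k < K → k' < K → Q k = Q k' → k = k')
    (hmono : ∀ k k', k ≤ k' → k' < K → Q k ∩ P a ⊆ Q k' ∩ P a)
    (hdisj : ∀ k k', k < K → k' < K → k ≠ k' → Q k ∩ Q k' ⊆ P a)
    (hpdef : ∀ k, p k = ∏ y ∈ Q k \ P a, (q y : ℝ))
    (hwdef : ∀ k, w k = ∏ y ∈ Q k ∩ P a, (q y : ℝ)) (j : ℕ) (ℓ : ℕ → ℝ) (hℓ : ∀ k, k < K → ℓ k ≤ p k)
    (hV : ∀ q' : ℕ → ℝ, (∀ k, k < K → q' k = ℓ k ∨ q' k = 1) →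
      x * CB[sz, q', K] ((j : ℤ) - (c : ℤ)) ≤
        ∑ k ∈ Finset.range K, (w k - x) * q' k * (CB[sz, q', k] (j : ℤ) - CB[sz, q', k] ((j : ℤ) - (sz k : ℤ)))) :
    (prodBernoulli q).real
        {ω : Set ι | (A.filter fun y => ((P y : Finset ι) : Set ι) ⊆ ω).card ≤ j} ≤ 1 - x := by
  have hq0 : ∀ y, (0 : ℝ) ≤ q y := fun y => (q y).2.1
  have hq1 : ∀ y, (q y : ℝ) ≤ 1 := fun y => (q y).2.2
  have hp1 : ∀ k, p k ≤ 1 := fun k => by rw [hpdef k]; exact Finset.prod_le_one (fun y _ => hq0 y) fun y _ => hq1 y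
  refine farTree_blockComb_of_exchange P q a x hx K A Q sz c p w ha hc hsz hcover hQne hinj hmono hdisj hpdef hwdef j ?_
  exact BlobWalk.exchange_le_of_vertices sz ℓ K (j : ℤ) c w x hV p fun k hk => ⟨hℓ k hk, hp1 k⟩

end Quant

end Summit.CriticalPhenomena.PercolationContinuityZ3.Theorems

end
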